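import Literature.Computability.AlgebraicComplexity.PermanentUniversality
import HarnessLib

/-!
# Path sums of transitive DAGs as sums over vertex subsets (chains)

The weighted path count `pathSum w n` of the transitive DAG on `{0, …, n}`
(`PermanentUniversality.lean`, the carrier of the DAG `ArithExpr.dagWeights` of an arithmetic
expression) is defined by the dynamic programme `P(b+1) = ∑_{a ≤ b} P(a) · w a (b+1)`. This file
gives its closed combinatorial form: a path `0 = v₀ < v₁ < ⋯ < v_r = m + 1` is the same thing as
the set `U = {v₁, …, v_{r-1}} ⊆ {1, …, m}` of internal vertices it visits, its weight being
`∏_{a ∈ {0} ∪ U} w a (nxt U (m+1) a)` where `nxt U s a` is the next element of `U` after `a`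
(or the sink `s`), and

  `pathSum w (m + 1) = ∑_{U ⊆ {1, …, m}} chainProd w U (m + 1)`      (`pathSum_eq_sum_chainProd`).

This is the form in which the Hamiltonian-cycle simulation of Boolean sums of path sums
(`HamiltonianPathSums.lean`) reads a path off a Hamiltonian cycle: the set of DAG vertices the
cycle enters along a DAG edge.

## References

* L. G. Valiant, *Completeness classes in algebra*, Proc. 11th STOC (1979), 249–261, §2.
* P. Bürgisser, M. Clausen, M. A. Shokrollahi, *Algebraic Complexity Theory*, Springer 1997,
  Ex. 21.7 (paths of the DAG of an expression).
-/

noncomputable section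

open Finset

namespace Literature.Computability.AlgebraicComplexity

variable {R : Type*} [CommSemiring R]

/-- The candidate set for the successor of `a` on the chain through `U` with sink `s`: the elements
of `U` above `a`, and `s`. [folklore] -/
def nxtSet (U : Finset ℕ) (s a : ℕ) : Finset ℕ :=
  insert s (U.filter fun c => a < c)

/-- The candidate set is nonempty (it contains the sink). [folklore] -/
theorem nxtSet_nonempty (U : Finset ℕ) (s a : ℕ) : (nxtSet U s a).Nonempty :=
  ⟨s, mem_insert_self _ _⟩

/-- The successor `nxt U s a` of `a` on the chain `0 < v₁ < ⋯ < v_r = s` through the vertex set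
`U`: the least element of `U` above `a`, or the sink `s` if there is none. [folklore] -/
def nxt (U : Finset ℕ) (s a : ℕ) : ℕ :=
  (nxtSet U s a).min' (nxtSet_nonempty U s a)

/-- `nxt U s a` is a candidate. [folklore] -/
theorem nxt_mem (U : Finset ℕ) (s a : ℕ) : nxt U s a ∈ nxtSet U s a :=
  Finset.min'_mem _ _

/-- `nxt U s a` is below every candidate. [folklore] -/
theorem nxt_le {U : Finset ℕ} {s a c : ℕ} (hc : c ∈ nxtSet U s a) : nxt U s a ≤ c :=
  Finset.min'_le _ _ hc

/-- Characterisation of `nxt` as the least candidate. [folklore] -/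
theorem nxt_eq_of {U : Finset ℕ} {s a x : ℕ} (hx : x ∈ nxtSet U s a)
    (hle : ∀ c ∈ nxtSet U s a, x ≤ c) : nxt U s a = x :=
  le_antisymm (nxt_le hx) (hle _ (nxt_mem U s a))

/-- Unfolding membership in the candidate set. [folklore] -/
theorem mem_nxtSet {U : Finset ℕ} {s a c : ℕ} : c ∈ nxtSet U s a ↔ c = s ∨ (c ∈ U ∧ a < c) := by
  simp [nxtSet]

/-- `nxt U s a` is the sink or an element of `U` above `a`. [folklore] -/
theorem nxt_eq_or (U : Finset ℕ) (s a : ℕ) : nxt U s a = s ∨ (nxt U s a ∈ U ∧ a < nxt U s a) :=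
  mem_nxtSet.1 (nxt_mem U s a)

/-- If every element of `U` and `a` are below the sink, `a < nxt U s a`. [folklore] -/
theorem lt_nxt {U : Finset ℕ} {s a : ℕ} (ha : a < s) : a < nxt U s a := by
  rcases nxt_eq_or U s a with h | h
  · rw [h]; exact ha
  · exact h.2

/-- No element of `U` lies strictly between `a` and `nxt U s a`. [folklore] -/
theorem not_mem_of_lt_nxt {U : Finset ℕ} {s a c : ℕ} (hac : a < c) (hc : c < nxt U s a) : c ∉ U :=
  fun hcU => absurd (nxt_le (mem_nxtSet.2 (Or.inr ⟨hcU, hac⟩))) (not_le.2 hc)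

/-- The weight of the chain (increasing path) `0 → v₁ → ⋯ → v_r → s` through the vertex set
`U = {v₁, …, v_r}`: the product of `w a (nxt U s a)` over `a ∈ {0} ∪ U`. [folklore] -/
def chainProd (w : ℕ → ℕ → R) (U : Finset ℕ) (s : ℕ) : R :=
  ∏ a ∈ insert 0 U, w a (nxt U s a)

/-- Raising the sink: if `U ⊆ {1, …, m}` then the chain through `U` with sink `m + 2` has the
weight of the chain with sink `m + 1` for the weights in which the edges into `m + 1` carry the
weights of the edges into `m + 2`. [folklore] -/
theorem chainProd_raise (w : ℕ → ℕ → R) (m : ℕ) {U : Finset ℕ} (hU : U ⊆ Icc 1 m) :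
    chainProd w U (m + 2) =
      chainProd (fun a c => if c = m + 1 then w a (m + 2) else w a c) U (m + 1) := by
  unfold chainProd
  refine prod_congr rfl fun a ha => ?_
  have hUle : ∀ c ∈ U, c ≤ m := fun c hc => (mem_Icc.1 (hU hc)).2
  rcases nxt_eq_or U (m + 1) a with h | h
  · -- no element of `U` above `a`: both successors are the sinks
    have hnone : ∀ c ∈ U, ¬ a < c := by
      intro c hc hac
      have := nxt_le (s := m + 1) (mem_nxtSet.2 (Or.inr ⟨hc, hac⟩))
      rw [h] at this
      exact absurd (hUle c hc) (by omega)
    have h2 : nxt U (m + 2) a = m + 2 :=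
      nxt_eq_of (mem_nxtSet.2 (Or.inl rfl)) fun c hc => by
        rcases mem_nxtSet.1 hc with rfl | ⟨hcU, hac⟩
        · exact le_rfl
        · exact absurd hac (hnone c hcU)
    rw [h, h2]; simp
  · -- the least element of `U` above `a` is the successor for both sinks
    have h2 : nxt U (m + 2) a = nxt U (m + 1) a :=
      nxt_eq_of (mem_nxtSet.2 (Or.inr h)) fun c hc => by
        rcases mem_nxtSet.1 hc with rfl | ⟨hcU, hac⟩
        · have := hUle _ h.1; omega
        · exact nxt_le (mem_nxtSet.2 (Or.inr ⟨hcU, hac⟩))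
    have hne : nxt U (m + 1) a ≠ m + 1 := by have := hUle _ h.1; omega
    rw [h2]; simp [hne]

/-- Adding the top vertex: the chain through `U ∪ {m + 1}` (`U ⊆ {1, …, m}`) with sink `m + 2` is
the chain through `U` with sink `m + 1` followed by the edge `m + 1 → m + 2`. [folklore] -/
theorem chainProd_insert_top (w : ℕ → ℕ → R) (m : ℕ) {U : Finset ℕ} (hU : U ⊆ Icc 1 m) :
    chainProd w (insert (m + 1) U) (m + 2) = chainProd w U (m + 1) * w (m + 1) (m + 2) := by
  unfold chainProd
  have hUle : ∀ c ∈ U, c ≤ m := fun c hc => (mem_Icc.1 (hU hc)).2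
  have hnot : m + 1 ∉ insert 0 U := by
    simp only [mem_insert, not_or]
    exact ⟨by omega, fun h => absurd (hUle _ h) (by omega)⟩
  rw [Finset.insert_comm, prod_insert hnot, mul_comm]
  congr 1
  · refine prod_congr rfl fun a ha => ?_
    have hale : a ≤ m := by
      rcases mem_insert.1 ha with rfl | h
      · exact Nat.zero_le _
      · exact hUle a h
    congr 1
    refine nxt_eq_of (mem_nxtSet.2 ?_) fun c hc => ?_
    · rcases nxt_eq_or U (m + 1) a with h | h
      · exact Or.inr ⟨by rw [h]; exact mem_insert_self _ _, lt_nxt (by omega)⟩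
      · exact Or.inr ⟨mem_insert_of_mem h.1, h.2⟩
    · rcases mem_nxtSet.1 hc with rfl | ⟨hcU, hac⟩
      · rcases nxt_eq_or U (m + 1) a with h | h
        · omega
        · have := hUle _ h.1; omega
      · rcases mem_insert.1 hcU with rfl | hcU
        · exact nxt_le (mem_nxtSet.2 (Or.inl rfl))
        · exact nxt_le (mem_nxtSet.2 (Or.inr ⟨hcU, hac⟩))
  · congr 1
    refine nxt_eq_of (mem_nxtSet.2 (Or.inl rfl)) fun c hc => ?_
    rcases mem_nxtSet.1 hc with rfl | ⟨hcU, hac⟩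
    · exact le_rfl
    · rcases mem_insert.1 hcU with rfl | hcU
      · omega
      · have := hUle _ hcU; omega

/-- Raising the sink in the dynamic programme: the paths to `m + 2` not through `m + 1` are the
paths to `m + 1` for the redirected weights, so
`P_w(m+2) = P_{w'}(m+1) + P_w(m+1) · w (m+1) (m+2)`. [folklore] -/
theorem pathSum_succ_succ (w : ℕ → ℕ → R) (m : ℕ) :
    pathSum w (m + 2) = pathSum (fun a c => if c = m + 1 then w a (m + 2) else w a c) (m + 1) +
      pathSum w (m + 1) * w (m + 1) (m + 2) := by
  set w' : ℕ → ℕ → R := fun a c => if c = m + 1 then w a (m + 2) else w a c with hw'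
  have hlow : ∀ a, a ≤ m → pathSum w' a = pathSum w a := fun a ha =>
    pathSum_congr fun a' c hc => by rw [hw']; dsimp only; rw [if_neg (by omega)]
  rw [pathSum_succ, Finset.sum_range_succ, pathSum_succ w' m]
  congr 1
  refine sum_congr rfl fun a ha => ?_
  rw [mem_range] at ha
  rw [hlow a (by omega), hw']
  simp

/-- **Path sums are chain sums.** The weighted path count from `0` to `m + 1` in the transitive
DAG on `{0, …, m+1}` is the sum, over the sets `U ⊆ {1, …, m}` of internal vertices, of the
weight of the increasing path through exactly the vertices of `U`
(Valiant 1979, §2; BCS 1997, Ex. 21.7: "`val(φ) = ∑_{π ∈ G(s,t)} λ(π)`"). [cite: BurgisserClausenShokrollahi1997, Ex. 21.7] -/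
theorem pathSum_eq_sum_chainProd (w : ℕ → ℕ → R) (m : ℕ) :
    pathSum w (m + 1) = ∑ U ∈ (Icc 1 m).powerset, chainProd w U (m + 1) := by
  induction m generalizing w with
  | zero =>
    have h0 : nxt ∅ 1 0 = 1 := nxt_eq_of (mem_nxtSet.2 (Or.inl rfl)) fun c hc => by
      rcases mem_nxtSet.1 hc with rfl | ⟨h, -⟩
      · exact le_rfl
      · exact absurd h (Finset.notMem_empty _)
    rw [pathSum_one, show Icc 1 0 = (∅ : Finset ℕ) from rfl, powerset_empty, sum_singleton]
    unfold chainProd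
    rw [insert_empty_eq, prod_singleton, h0]
  | succ m ih =>
    rw [pathSum_succ_succ, ih, ih, ← Finset.insert_Icc_right_eq_Icc_add_one (by omega),
      sum_powerset_insert (by simp), sum_mul]
    congr 1
    · exact sum_congr rfl fun U hU => (chainProd_raise w m (mem_powerset.1 hU)).symm
    · exact sum_congr rfl fun U hU => (chainProd_insert_top w m (mem_powerset.1 hU)).symm

/-- Path sums commute with semiring homomorphisms applied to the weights. [folklore] -/
theorem map_pathSum {S : Type*} [CommSemiring S] (f : R →+* S) (w : ℕ → ℕ → R) (n : ℕ) :
    f (pathSum w n) = pathSum (fun a c => f (w a c)) n := by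
  induction n using Nat.strong_induction_on with
  | _ n ih =>
    cases n with
    | zero => rw [pathSum_zero, pathSum_zero, map_one]
    | succ b =>
      rw [pathSum_succ, pathSum_succ, map_sum]
      refine sum_congr rfl fun a ha => ?_
      rw [mem_range] at ha
      rw [map_mul, ih a ha]

end Literature.Computability.AlgebraicComplexity
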